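import Mathlib
import Literature.MathematicalPhysics.StatisticalMechanics.Crystallization
import Literature.MathematicalPhysics.StatisticalMechanics.LennardJonesClusters
import Literature.MathematicalPhysics.StatisticalMechanics.SeparatedShellSums
import Summits.AtomisticToContinuum.Crystallization.Theorems.BraggSlacknessRigiditySlacknessTransferFourier
import Summits.AtomisticToContinuum.Crystallization.Theorems.BraggSlacknessRigidityHcpDiffractionRigidityDenseCentresAux
import Summits.AtomisticToContinuum.Crystallization.Theorems.BraggSlacknessRigidityHcpDiffractionRigidityDenseCentresAux2

/-!
# Dense centres (stub `stub_denseCentres` of crux `HcpDiffractionRigidity`,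
# item `stmt-AtomisticToContinuum-13166`, line `registered`)

**Small-angle `S3` ⇒ no density deficits.** For a hard-core sequence of `N`-point configurations
`x^N` in `ℝ³` whose structure factor `|S_N|²` carries `o(N)` mass on every admissible test function
(continuous, compact support off `0` and off the Bragg spheres of a periodic template `P`), for
every `ε > 0` there are `θ > 0` and `L₀` such that for every scale `L ≥ L₀`, eventually in `N`, at
most `εN` particles `i` have Gaussian mass `∑ⱼ e^{-2|xⱼ - xᵢ|²/L²} < θ L³`.

Proof: two-scale kernel `ψ = G_a − (a/b)³ G_b` (`G_s(v) = e^{-π|v|²/s²}`, `b = L√π/2`),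
`F = ∑ₖ ψ(· − xₖ)`.  By Plancherel for Gaussian sums (Aux file 1) `∫ F² = ∫ t²|S_N|²` with
`t = a³(e^{-πa²|ξ|²} − e^{-πb²|ξ|²})`, `t(0) = 0`; `t²` is split (`tprof_sq_le`) into an
admissible part (cutoff between `η` and `r/4`, `r` the first Bragg radius of `P`, Aux file 2),
which is `o(N)` by `S3`, and Gaussian-dominated remainders near `0` and beyond `r/4`, which are
`≤ (c₁ + c₂)·2(2/δ+1)³ N` by Gaussian almost orthogonality (`integral_gauss_sf_le`, shell counting
of Aux file 2), small for `a` large and `η` small.  On the other hand `F ≥ 1/4` on the ball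
`B(xⱼ, ρ)` about every particle with Gaussian mass `≤ (b/a)³/8` at scale `b√2` (self term of
`G_a`, Aux file 2), so `#bad · vol(B_ρ)/16 ≤ ∫ F²` (`card_sparse_le`).  With `γ = ε vol(B_ρ)/16`,
`a = a(γ)`, `θ = π√π/(64a³)` and `L₀ = 2a` the statement follows.  All `[folklore]`.
-/

noncomputable section

namespace Summit.AtomisticToContinuum.Crystallization.Theorems

open MeasureTheory Metric Filter Complex
open scoped BigOperators Classical Real RealInnerProductSpace
open Literature.MathematicalPhysics.StatisticalMechanics
open Summit.AtomisticToContinuum.Crystallization.Theorems.BraggSlacknessTransfer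

namespace HcpRigidityDenseCentres

/-! ## Gaussian almost orthogonality -/

/-- **Gaussian almost orthogonality.** For a `δ`-separated configuration and `s ≥ 1`,
`∫ e^{-π s²|ξ|²} |S_N(ξ)|² dξ = s⁻³ ∑ₖ∑ₗ e^{-π|yₖ-yₗ|²/s²} ≤ 2(2/δ+1)³ N`. [folklore] -/
theorem integral_gauss_sf_le {N : ℕ} (y : Fin N → EuclideanSpace ℝ (Fin 3)) {δ : ℝ} (hδ : 0 < δ)
    (hsep : ∀ i j : Fin N, i ≠ j → δ ≤ dist (y i) (y j)) {s : ℝ} (hs : 1 ≤ s) :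
    ∫ ξ : EuclideanSpace ℝ (Fin 3), Real.exp (-(Real.pi * s ^ 2) * ‖ξ‖ ^ 2) *
        ‖∑ j, cexp (2 * Real.pi * I * (⟪ξ, y j⟫ : ℂ))‖ ^ 2 ≤ 2 * (2 / δ + 1) ^ 3 * N := by
  have hs0 : 0 < s := by linarith
  have hW := integral_normSq_gaussSum (fun _ : Fin N => (1 : ℝ)) (fun _ => Real.pi * s ^ 2 / 2)
    (fun _ => by positivity) y
  have hpt : ∀ ξ : EuclideanSpace ℝ (Fin 3), ‖∑ i, (((1 : ℝ) * Real.exp (-(Real.pi * s ^ 2 / 2) * ‖ξ‖ ^ 2) : ℝ) : ℂ) *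
      cexp (2 * Real.pi * I * (⟪ξ, y i⟫ : ℂ))‖ ^ 2 =
      Real.exp (-(Real.pi * s ^ 2) * ‖ξ‖ ^ 2) *
        ‖∑ j, cexp (2 * Real.pi * I * (⟪ξ, y j⟫ : ℂ))‖ ^ 2 := by
    intro ξ
    rw [← Finset.mul_sum, norm_mul, mul_pow, Complex.norm_real, Real.norm_eq_abs, sq_abs, one_mul,
      sq, ← Real.exp_add]
    congr 2
    ring
  simp_rw [hpt] at hW
  rw [hW]
  have hbase : Real.pi / (Real.pi * s ^ 2 / 2 + Real.pi * s ^ 2 / 2) = (s⁻¹) ^ 2 := by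
    field_simp
    norm_num
  have hterm : ∀ i j : Fin N, (1 : ℝ) * 1 *
      ((Real.pi / (Real.pi * s ^ 2 / 2 + Real.pi * s ^ 2 / 2)) ^ ((3 : ℝ) / 2) *
        Real.exp (-(Real.pi ^ 2 * ‖y i - y j‖ ^ 2 / (Real.pi * s ^ 2 / 2 + Real.pi * s ^ 2 / 2)))) =
      s⁻¹ ^ 3 * Real.exp (-(Real.pi / s ^ 2) * ‖y j - y i‖ ^ 2) := by
    intro i j
    have h32 : (s⁻¹ ^ 2) ^ ((3 : ℝ) / 2) = s⁻¹ ^ 3 := by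
      rw [← Real.rpow_natCast s⁻¹ 2, ← Real.rpow_mul (by positivity)]; norm_num
    rw [hbase, h32, norm_sub_rev, one_mul, one_mul]
    congr 2
    field_simp
    norm_num
  simp_rw [hterm, ← Finset.mul_sum]
  calc s⁻¹ ^ 3 * ∑ i, ∑ j, Real.exp (-(Real.pi / s ^ 2) * ‖y j - y i‖ ^ 2)
      ≤ s⁻¹ ^ 3 * ∑ _i : Fin N, (2 * (2 / δ + 1) ^ 3 * s ^ 3) := by
        gcongr with i _
        exact sum_exp_le y hδ hsep i hs
    _ = 2 * (2 / δ + 1) ^ 3 * N := by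
        rw [Finset.sum_const, Finset.card_univ, Fintype.card_fin, nsmul_eq_mul]
        field_simp

/-! ## Pointwise bound for the Fourier profile -/

/-! ## Pointwise and integrated bounds for the Fourier profile -/

/-- **Pointwise bound.** For `1 ≤ a ≤ b`, `η, r > 0` and a cutoff `χ ∈ [0,1]` with `χ = 1` on
`η ≤ |ξ| ≤ r/4`: `t² ≤ t² χ + π²a⁶b⁴η⁴e^{πη²} · e^{-π|ξ|²} + a⁶e^{-πa²r²/16} · e^{-πa²|ξ|²}`
(`0 ≤ e^{-πa²u} − e^{-πb²u} ≤ min(e^{-πa²u}, πb²u)`). [folklore] -/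
theorem tprof_sq_le {a b η r : ℝ} (ha : 1 ≤ a) (hab : a ≤ b) (hη : 0 < η) (hr : 0 < r)
    {χ : EuclideanSpace ℝ (Fin 3) → ℝ} (hχ01 : ∀ ξ, 0 ≤ χ ξ ∧ χ ξ ≤ 1)
    (hχ1 : ∀ ξ : EuclideanSpace ℝ (Fin 3), η ≤ ‖ξ‖ → ‖ξ‖ ≤ r / 4 → χ ξ = 1) (ξ : EuclideanSpace ℝ (Fin 3)) :
    (a ^ 3 * Real.exp (-(Real.pi * a ^ 2) * ‖ξ‖ ^ 2) - a ^ 3 * Real.exp (-(Real.pi * b ^ 2) * ‖ξ‖ ^ 2)) ^ 2 ≤ (a ^ 3 * Real.exp (-(Real.pi * a ^ 2) * ‖ξ‖ ^ 2) - a ^ 3 * Real.exp (-(Real.pi * b ^ 2) * ‖ξ‖ ^ 2)) ^ 2 * χ ξ +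
      Real.pi ^ 2 * a ^ 6 * b ^ 4 * η ^ 4 * Real.exp (Real.pi * η ^ 2) *
        Real.exp (-Real.pi * ‖ξ‖ ^ 2) +
      a ^ 6 * Real.exp (-(Real.pi * a ^ 2 * r ^ 2 / 16)) *
        Real.exp (-(Real.pi * a ^ 2) * ‖ξ‖ ^ 2) := by
  have ha0 : 0 < a := by linarith
  have hpi := Real.pi_pos
  set t := ‖ξ‖ ^ 2 with ht
  have ht0 : 0 ≤ t := sq_nonneg _
  set D := Real.exp (-(Real.pi * a ^ 2) * t) - Real.exp (-(Real.pi * b ^ 2) * t) with hD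
  have htp : (a ^ 3 * Real.exp (-(Real.pi * a ^ 2) * ‖ξ‖ ^ 2) - a ^ 3 * Real.exp (-(Real.pi * b ^ 2) * ‖ξ‖ ^ 2)) = a ^ 3 * D := by rw [hD]; ring
  have hab2 : a ^ 2 ≤ b ^ 2 := pow_le_pow_left₀ ha0.le hab 2
  have hD0 : 0 ≤ D := by
    rw [hD, sub_nonneg, Real.exp_le_exp]
    nlinarith [mul_le_mul_of_nonneg_right hab2 (mul_nonneg hpi.le ht0)]
  have hDle : D ≤ Real.exp (-(Real.pi * a ^ 2) * t) := by
    rw [hD]; linarith [Real.exp_pos (-(Real.pi * b ^ 2) * t)]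
  have hDlin : D ≤ Real.pi * b ^ 2 * t := by
    have h1 : Real.exp (-(Real.pi * a ^ 2) * t) ≤ 1 := by
      rw [Real.exp_le_one_iff]; nlinarith [mul_nonneg (mul_nonneg hpi.le (sq_nonneg a)) ht0]
    have h2 : -(Real.pi * b ^ 2) * t + 1 ≤ Real.exp (-(Real.pi * b ^ 2) * t) :=
      Real.add_one_le_exp _
    rw [hD]; linarith
  have hnn1 : 0 ≤ (a ^ 3 * Real.exp (-(Real.pi * a ^ 2) * ‖ξ‖ ^ 2) - a ^ 3 * Real.exp (-(Real.pi * b ^ 2) * ‖ξ‖ ^ 2)) ^ 2 * χ ξ := mul_nonneg (sq_nonneg _) (hχ01 ξ).1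
  have hnn2 : 0 ≤ Real.pi ^ 2 * a ^ 6 * b ^ 4 * η ^ 4 * Real.exp (Real.pi * η ^ 2) *
      Real.exp (-Real.pi * ‖ξ‖ ^ 2) := by positivity
  have hnn3 : 0 ≤ a ^ 6 * Real.exp (-(Real.pi * a ^ 2 * r ^ 2 / 16)) *
      Real.exp (-(Real.pi * a ^ 2) * ‖ξ‖ ^ 2) := by positivity
  rcases lt_or_ge ‖ξ‖ η with hsmall | hge
  · -- small frequencies: `t² ≤ π² a⁶ b⁴ |ξ|⁴`
    have hmain : (a ^ 3 * Real.exp (-(Real.pi * a ^ 2) * ‖ξ‖ ^ 2) - a ^ 3 * Real.exp (-(Real.pi * b ^ 2) * ‖ξ‖ ^ 2)) ^ 2 ≤ Real.pi ^ 2 * a ^ 6 * b ^ 4 * η ^ 4 *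
        Real.exp (Real.pi * η ^ 2) * Real.exp (-Real.pi * ‖ξ‖ ^ 2) := by
      rw [htp, mul_pow, ← ht]
      have hD2 : D ^ 2 ≤ (Real.pi * b ^ 2 * t) ^ 2 := pow_le_pow_left₀ hD0 hDlin 2
      have ht_le : t ≤ η ^ 2 := by rw [ht]; exact pow_le_pow_left₀ (norm_nonneg _) hsmall.le 2
      have ht2 : t ^ 2 ≤ η ^ 4 := by nlinarith
      have hexp1 : 1 ≤ Real.exp (Real.pi * η ^ 2) * Real.exp (-Real.pi * t) := by
        rw [← Real.exp_add]; exact Real.one_le_exp (by nlinarith)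
      calc (a ^ 3) ^ 2 * D ^ 2 ≤ (a ^ 3) ^ 2 * (Real.pi * b ^ 2 * t) ^ 2 := by gcongr
        _ = Real.pi ^ 2 * a ^ 6 * b ^ 4 * t ^ 2 := by ring
        _ ≤ Real.pi ^ 2 * a ^ 6 * b ^ 4 * η ^ 4 := by gcongr
        _ ≤ Real.pi ^ 2 * a ^ 6 * b ^ 4 * η ^ 4 *
            (Real.exp (Real.pi * η ^ 2) * Real.exp (-Real.pi * t)) :=
          le_mul_of_one_le_right (by positivity) hexp1
        _ = _ := by ring
    linarith
  rcases le_or_gt ‖ξ‖ (r / 4) with hmid | hlarge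
  · -- middle frequencies: `χ = 1`
    rw [hχ1 ξ hge hmid, mul_one]; linarith
  · -- large frequencies: `t² ≤ a⁶ e^{-2πa²|ξ|²}`
    have hmain : (a ^ 3 * Real.exp (-(Real.pi * a ^ 2) * ‖ξ‖ ^ 2) - a ^ 3 * Real.exp (-(Real.pi * b ^ 2) * ‖ξ‖ ^ 2)) ^ 2 ≤ a ^ 6 * Real.exp (-(Real.pi * a ^ 2 * r ^ 2 / 16)) *
        Real.exp (-(Real.pi * a ^ 2) * ‖ξ‖ ^ 2) := by
      rw [htp, mul_pow, ← ht]
      have hD2 : D ^ 2 ≤ Real.exp (-(Real.pi * a ^ 2) * t) ^ 2 := pow_le_pow_left₀ hD0 hDle 2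
      have ht_ge : (r / 4) ^ 2 ≤ t := by
        rw [ht]; exact pow_le_pow_left₀ (by positivity) hlarge.le 2
      have hE : Real.exp (-(Real.pi * a ^ 2) * t) ≤ Real.exp (-(Real.pi * a ^ 2 * r ^ 2 / 16)) :=
        Real.exp_le_exp.2 (by nlinarith [mul_pos hpi (pow_pos ha0 2)])
      calc (a ^ 3) ^ 2 * D ^ 2 ≤ (a ^ 3) ^ 2 * Real.exp (-(Real.pi * a ^ 2) * t) ^ 2 := by gcongr
        _ = a ^ 6 * Real.exp (-(Real.pi * a ^ 2) * t) * Real.exp (-(Real.pi * a ^ 2) * t) := by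
            ring
        _ ≤ a ^ 6 * Real.exp (-(Real.pi * a ^ 2 * r ^ 2 / 16)) *
            Real.exp (-(Real.pi * a ^ 2) * t) := by gcongr
    linarith

/-! ## The fixed-`N` estimate and the stub -/

/-- **Fixed-`N` estimate.** For a `δ`-separated configuration `y`, scales `1 ≤ a ≤ b`, a radius
`ρ ≤ min(δ/2, 1/4)` and a pointwise splitting `t² ≤ h + c₁e^{-π|ξ|²} + c₂e^{-πa²|ξ|²}`:
`#{j : mass of j at scale b√2 ≤ (b/a)³/8} · vol(B_ρ)/16 ≤ ∫ h|S_N|² + (c₁ + c₂)·2(2/δ+1)³·N`.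
[folklore] -/
theorem card_sparse_le {N : ℕ} (y : Fin N → EuclideanSpace ℝ (Fin 3)) {δ : ℝ} (hδ : 0 < δ)
    (hsep : ∀ i j : Fin N, i ≠ j → δ ≤ dist (y i) (y j)) {a b ρ : ℝ} (ha : 1 ≤ a) (hab : a ≤ b)
    (hρ0 : 0 < ρ) (hρδ : ρ + ρ ≤ δ) (hρ4 : ρ ≤ 1 / 4) {h : EuclideanSpace ℝ (Fin 3) → ℝ} (hhc : Continuous h)
    (hhs : HasCompactSupport h) {c₁ c₂ : ℝ} (hc₁ : 0 ≤ c₁) (hc₂ : 0 ≤ c₂)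
    (hpt : ∀ ξ : EuclideanSpace ℝ (Fin 3), (a ^ 3 * Real.exp (-(Real.pi * a ^ 2) * ‖ξ‖ ^ 2) - a ^ 3 * Real.exp (-(Real.pi * b ^ 2) * ‖ξ‖ ^ 2)) ^ 2 ≤ h ξ + c₁ * Real.exp (-Real.pi * ‖ξ‖ ^ 2) +
      c₂ * Real.exp (-(Real.pi * a ^ 2) * ‖ξ‖ ^ 2)) :
    ((Finset.univ.filter fun j : Fin N =>
        ∑ k, Real.exp (-(Real.pi / (2 * b ^ 2)) * ‖y k - y j‖ ^ 2) ≤ (b / a) ^ 3 / 8).card : ℝ) *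
        (volume (ball (0 : EuclideanSpace ℝ (Fin 3)) ρ)).toReal * (1 / 16) ≤
      (∫ ξ : EuclideanSpace ℝ (Fin 3), h ξ * ‖∑ j, cexp (2 * Real.pi * I * (⟪ξ, y j⟫ : ℂ))‖ ^ 2) +
        (c₁ + c₂) * (2 * (2 / δ + 1) ^ 3 * N) := by
  have ha0 : 0 < a := by linarith
  have hb1 : 1 ≤ b := ha.trans hab
  have hb0 : 0 < b := by linarith
  set B := Finset.univ.filter fun j : Fin N =>
    ∑ k, Real.exp (-(Real.pi / (2 * b ^ 2)) * ‖y k - y j‖ ^ 2) ≤ (b / a) ^ 3 / 8 with hB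
  -- `#B · vol(B_ρ) / 16 ≤ ∫ F²`
  have h1 : (B.card : ℝ) * (volume (ball (0 : EuclideanSpace ℝ (Fin 3)) ρ)).toReal * (1 / 16) ≤
      ∫ z : EuclideanSpace ℝ (Fin 3), (∑ k, (Real.exp (-(Real.pi / a ^ 2) * ‖z - y k‖ ^ 2) -
      (a / b) ^ 3 * Real.exp (-(Real.pi / b ^ 2) * ‖z - y k‖ ^ 2))) ^ 2 := by
    refine card_mul_volume_le_integral y B (fun i _ j _ hij => hρδ.trans (hsep i j hij))
      (integrable_kernelSum_sq y ha0 hb0) (fun z => sq_nonneg _) fun j hj z hz => ?_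
    rw [hB, Finset.mem_filter] at hj
    have hq := quarter_le_kernelSum y ha hb1 hρ4 j hj.2 z hz
    nlinarith
  -- `∫ F² = ∫ t² |S_N|² ≤ ∫ h |S_N|² + c₁ ∫ e^{-π|ξ|²}|S_N|² + c₂ ∫ e^{-πa²|ξ|²}|S_N|²`
  rw [integral_kernelSum_sq y ha0 hb0] at h1
  have h2 := integral_tprof_sf_le y ha0 (b := b) hhc hhs hpt
  -- almost orthogonality at scales `1` and `a`
  have h3 := integral_gauss_sf_le y hδ hsep (le_refl (1 : ℝ))
  simp only [one_pow, mul_one] at h3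
  have h4 := integral_gauss_sf_le y hδ hsep ha
  have hK : 0 ≤ 2 * (2 / δ + 1) ^ 3 * (N : ℝ) := by positivity
  nlinarith [mul_le_mul_of_nonneg_left h3 hc₁, mul_le_mul_of_nonneg_left h4 hc₂]


end HcpRigidityDenseCentres

open HcpRigidityDenseCentres

/-- **STUB A1 — dense centres (non-sparseness of typical particles; Fourier, small-angle S3).**
For any periodic template `P`, hard core `δ` and a sequence `x^N` with Bragg-quiet structure factor
(S3): for every `ε > 0` there are `θ > 0` and `L₀` such that for every scale `L ≥ L₀`, eventually
in `N`, at most `εN` particles `i` have Gaussian mass `Σ_j exp(-‖x_j - x_i‖²/L²)² < θ L³`.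
[folklore] -/
theorem stub_denseCentres : ∀ (P : Literature.MathematicalPhysics.StatisticalMechanics.PeriodicConfiguration 3) (δ : ℝ), 0 < δ → ∀ x : (N : ℕ) → (Fin N → EuclideanSpace ℝ (Fin 3)), (∀ (N : ℕ) (i j : Fin N), i ≠ j → δ ≤ dist (x N i) (x N j)) → (∀ h : EuclideanSpace ℝ (Fin 3) → ℝ, Continuous h → HasCompactSupport h → (∀ ξ ∈ tsupport h, ξ ≠ 0 ∧ ∀ k : EuclideanSpace ℝ (Fin 3), (∀ g ∈ P.lattice, ∃ n : ℤ, inner ℝ k g = (n : ℝ)) → ‖ξ‖ ≠ ‖k‖) → Filter.Tendsto (fun N : ℕ => (∫ ξ, h ξ * ‖∑ j : Fin N, Complex.exp (2 * Real.pi * Complex.I * (inner ℝ ξ (x N j) : ℂ))‖ ^ 2) / N) Filter.atTop (nhds 0)) → ∀ ε : ℝ, 0 < ε → ∃ θ : ℝ, 0 < θ ∧ ∃ L₀ : ℝ, ∀ L : ℝ, L₀ ≤ L → ∀ᶠ N : ℕ in Filter.atTop, ((Finset.univ.filter (fun i : Fin N => ∑ j : Fin N, Real.exp (-(‖x N j -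 x N i‖ ^ 2) / L ^ 2) ^ 2 < θ * L ^ 3)).card : ℝ) ≤ ε * N := by
  intro P δ hδ x hsep hS3 ε hε
  -- constants depending on `P`, `δ`, `ε` only
  obtain ⟨r, hr, hdual⟩ := exists_pos_le_norm_of_dual P
  set K : ℝ := 2 * (2 / δ + 1) ^ 3 with hK
  have hK0 : 0 < K := by positivity
  set ρ : ℝ := min (δ / 2) (1 / 4) with hρ
  have hρ0 : 0 < ρ := lt_min (by positivity) (by norm_num)
  have hρδ : ρ + ρ ≤ δ := by have := min_le_left (δ / 2) (1 / 4); linarith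
  have hρ4 : ρ ≤ 1 / 4 := min_le_right _ _
  set v : ℝ := (volume (ball (0 : EuclideanSpace ℝ (Fin 3)) ρ)).toReal with hv
  have hv0 : 0 < v := ENNReal.toReal_pos (measure_ball_pos _ _ hρ0).ne' measure_ball_lt_top.ne
  set γ : ℝ := ε * v / 16 with hγ
  have hγ0 : 0 < γ := by positivity
  obtain ⟨a, ha1, haK⟩ := exists_scale (K := K) hr (by positivity : 0 < γ / 4)
  have ha0 : 0 < a := by linarith
  have hsqrtpi : 1 ≤ Real.sqrt Real.pi := by
    rw [← Real.sqrt_one]; exact Real.sqrt_le_sqrt (by linarith [Real.pi_gt_three])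
  have hsqrt0 : 0 < Real.sqrt Real.pi := by linarith
  refine ⟨Real.pi * Real.sqrt Real.pi / (64 * a ^ 3), by positivity, 2 * a, fun L hL => ?_⟩
  -- the outer scale `b = L√π/2 ≥ a`
  have hL0 : 0 < L := by linarith
  set b : ℝ := L * Real.sqrt Real.pi / 2 with hb
  have hab : a ≤ b := by rw [hb]; nlinarith
  have hb0 : 0 < b := by linarith
  have hb2 : 2 * b ^ 2 = Real.pi * L ^ 2 / 2 := by
    rw [hb]; ring_nf; rw [Real.sq_sqrt Real.pi_pos.le]
  -- the small-angle cutoff scale `η`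
  set C₁ : ℝ := Real.pi ^ 2 * a ^ 6 * b ^ 4 * Real.exp Real.pi * K with hC₁
  have hC₁0 : 0 < C₁ := by positivity
  set η : ℝ := min 1 (γ / 4 / C₁) with hη
  have hη0 : 0 < η := lt_min one_pos (by positivity)
  have hη1 : η ≤ 1 := min_le_left _ _
  have hηC : C₁ * η ≤ γ / 4 := by
    have := min_le_right 1 (γ / 4 / C₁)
    rw [← hη, le_div_iff₀ hC₁0] at this
    linarith
  have hc₁K : Real.pi ^ 2 * a ^ 6 * b ^ 4 * η ^ 4 * Real.exp (Real.pi * η ^ 2) * K ≤ γ / 4 := by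
    have hη4 : η ^ 4 ≤ η := by
      have : η ^ 4 ≤ η ^ 1 := pow_le_pow_of_le_one hη0.le hη1 (by norm_num)
      rwa [pow_one] at this
    have hexp : Real.exp (Real.pi * η ^ 2) ≤ Real.exp Real.pi := by
      rw [Real.exp_le_exp]; nlinarith [Real.pi_pos, pow_le_one₀ hη0.le hη1 (n := 2)]
    calc Real.pi ^ 2 * a ^ 6 * b ^ 4 * η ^ 4 * Real.exp (Real.pi * η ^ 2) * K
        ≤ Real.pi ^ 2 * a ^ 6 * b ^ 4 * η * Real.exp Real.pi * K := by gcongr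
      _ = C₁ * η := by rw [hC₁]; ring
      _ ≤ γ / 4 := hηC
  -- the admissible test function `h = t² χ`
  obtain ⟨χ, hχc, hχs, hχ01, hχ1, hχsupp⟩ := exists_cutoff hη0 hr
  set h : EuclideanSpace ℝ (Fin 3) → ℝ := fun ξ =>
    (a ^ 3 * Real.exp (-(Real.pi * a ^ 2) * ‖ξ‖ ^ 2) - a ^ 3 * Real.exp (-(Real.pi * b ^ 2) * ‖ξ‖ ^ 2)) ^ 2 * χ ξ with hh
  have htc : Continuous fun ξ : EuclideanSpace ℝ (Fin 3) => (a ^ 3 * Real.exp (-(Real.pi * a ^ 2) * ‖ξ‖ ^ 2) - a ^ 3 * Real.exp (-(Real.pi * b ^ 2) * ‖ξ‖ ^ 2)) := by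
    fun_prop
  have hhc : Continuous h := (htc.pow 2).mul hχc
  have hhs : HasCompactSupport h := hχs.mul_left
  have hadm : ∀ ξ ∈ tsupport h, ξ ≠ 0 ∧ ∀ k : EuclideanSpace ℝ (Fin 3),
      (∀ g ∈ P.lattice, ∃ n : ℤ, inner ℝ k g = (n : ℝ)) → ‖ξ‖ ≠ ‖k‖ := by
    intro ξ hξ
    obtain ⟨h1, h2⟩ := hχsupp ξ (tsupport_mul_subset_right hξ)
    refine ⟨fun h0 => ?_, fun k hk heq => ?_⟩
    · rw [h0, norm_zero] at h1; linarith
    · by_cases hk0 : k = 0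
      · rw [heq, hk0, norm_zero] at h1; linarith
      · have := hdual k hk hk0; rw [← heq] at this; linarith
  have hev := (hS3 h hhc hhs hadm).eventually_lt_const (show (0 : ℝ) < γ / 4 by positivity)
  filter_upwards [hev, eventually_gt_atTop 0] with N hN hNpos
  have hNr : (0 : ℝ) < N := by exact_mod_cast hNpos
  have hint : ∫ ξ, h ξ * ‖∑ j : Fin N, Complex.exp (2 * Real.pi * Complex.I *
      (inner ℝ ξ (x N j) : ℂ))‖ ^ 2 ≤ γ / 4 * N := by
    rw [div_lt_iff₀ hNr] at hN; exact hN.le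
  -- the fixed-`N` estimate
  have hpt : ∀ ξ : EuclideanSpace ℝ (Fin 3), (a ^ 3 * Real.exp (-(Real.pi * a ^ 2) * ‖ξ‖ ^ 2) - a ^ 3 * Real.exp (-(Real.pi * b ^ 2) * ‖ξ‖ ^ 2)) ^ 2 ≤ h ξ +
      Real.pi ^ 2 * a ^ 6 * b ^ 4 * η ^ 4 * Real.exp (Real.pi * η ^ 2) *
        Real.exp (-Real.pi * ‖ξ‖ ^ 2) +
      a ^ 6 * Real.exp (-(Real.pi * a ^ 2 * r ^ 2 / 16)) *
        Real.exp (-(Real.pi * a ^ 2) * ‖ξ‖ ^ 2) := fun ξ =>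
    tprof_sq_le ha1 hab hη0 hr hχ01 hχ1 ξ
  have hkey := card_sparse_le (x N) hδ (hsep N) ha1 hab hρ0 hρδ hρ4 hhc hhs (by positivity)
    (by positivity) hpt
  rw [← hK, ← hv, add_mul] at hkey
  -- the set of the statement is contained in the sparse set
  have hq : Real.pi / (2 * b ^ 2) = 2 / L ^ 2 := by rw [hb2]; field_simp
  have hθ : Real.pi * Real.sqrt Real.pi / (64 * a ^ 3) * L ^ 3 = (b / a) ^ 3 / 8 := by
    have h3 : Real.sqrt Real.pi ^ 3 = Real.pi * Real.sqrt Real.pi := by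
      rw [pow_succ, Real.sq_sqrt Real.pi_pos.le]
    rw [hb, div_pow, div_pow, mul_pow, h3]
    field_simp
    ring
  have hsub : (Finset.univ.filter fun i : Fin N => ∑ j : Fin N,
      Real.exp (-(‖x N j - x N i‖ ^ 2) / L ^ 2) ^ 2 < Real.pi * Real.sqrt Real.pi / (64 * a ^ 3) * L ^ 3) ⊆
      Finset.univ.filter fun i : Fin N =>
        ∑ j, Real.exp (-(Real.pi / (2 * b ^ 2)) * ‖x N j - x N i‖ ^ 2) ≤ (b / a) ^ 3 / 8 := by
    intro i hi
    rw [Finset.mem_filter] at hi ⊢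
    refine ⟨hi.1, ?_⟩
    have hterm : ∀ j : Fin N, Real.exp (-(‖x N j - x N i‖ ^ 2) / L ^ 2) ^ 2 =
        Real.exp (-(Real.pi / (2 * b ^ 2)) * ‖x N j - x N i‖ ^ 2) := by
      intro j
      rw [sq, ← Real.exp_add, hq]
      congr 1
      field_simp
      ring
    have := hi.2
    simp_rw [hterm, hθ] at this
    exact this.le
  have hcard := Finset.card_le_card hsub
  have hcardR : ((Finset.univ.filter fun i : Fin N => ∑ j : Fin N,
      Real.exp (-(‖x N j - x N i‖ ^ 2) / L ^ 2) ^ 2 <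
        Real.pi * Real.sqrt Real.pi / (64 * a ^ 3) * L ^ 3).card : ℝ) ≤
      ((Finset.univ.filter fun i : Fin N =>
        ∑ j, Real.exp (-(Real.pi / (2 * b ^ 2)) * ‖x N j - x N i‖ ^ 2) ≤ (b / a) ^ 3 / 8).card : ℝ) := by
    exact_mod_cast hcard
  -- bookkeeping: `#bad · v / 16 ≤ (3γ/4) N = (3ε/4) N · v / 16`
  have hN0 : (0 : ℝ) ≤ N := hNr.le
  have htot : ((Finset.univ.filter fun i : Fin N =>
        ∑ j, Real.exp (-(Real.pi / (2 * b ^ 2)) * ‖x N j - x N i‖ ^ 2) ≤ (b / a) ^ 3 / 8).card : ℝ) *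
      v * (1 / 16) ≤ (3 / 4 * ε * N) * v * (1 / 16) := by
    have e1 : (3 / 4 * ε * N) * v * (1 / 16) = γ / 4 * N + (γ / 4 * N + γ / 4 * N) := by
      rw [hγ]; ring
    rw [e1]
    refine hkey.trans (add_le_add hint (add_le_add ?_ ?_))
    · calc _ = Real.pi ^ 2 * a ^ 6 * b ^ 4 * η ^ 4 * Real.exp (Real.pi * η ^ 2) * K * N := by ring
        _ ≤ γ / 4 * N := mul_le_mul_of_nonneg_right hc₁K hN0
    · calc _ = a ^ 6 * Real.exp (-(Real.pi * a ^ 2 * r ^ 2 / 16)) * K * N := by ring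
        _ ≤ γ / 4 * N := mul_le_mul_of_nonneg_right haK hN0
  have hfin := le_of_mul_le_mul_right (le_of_mul_le_mul_right htot (by norm_num : (0:ℝ) < 1 / 16)) hv0
  have h34 : 3 / 4 * ε * (N : ℝ) ≤ ε * N :=
    mul_le_mul_of_nonneg_right (by linarith only [hε]) hN0
  exact hcardR.trans (hfin.trans h34)

end Summit.AtomisticToContinuum.Crystallization.Theorems

end
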